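import Summits.ResolutionOfSingularities.ResolutionOfSingularities.Theorems.PurelyInseparableDim4ResConeBinaryPairTail
import HarnessLib
import HarnessLib.Audit.Tags

/-!
# Purely inseparable four-folds — NO BINARY-CONE TAIL ON A LIGHT PAIR WITH A THIRD, IDLE LETTER
# (idea-4's class A∞ `(1,1,1), d = 3` made `p`-, `d`-free; K2(p) lane, SLICE C (C9), file-holder res-dim4-p-5 g3)

[OURS · counted 0 · cell `res-dim4-pi` · K2(p) lane (desk WORDS #78 (d), #80 (d), #96 (b), #105 (d)) · seat p-5 g3.]
Nothing here proves K2(p), `NoIsolatedTrap p p` or resolution of singularities in dimension ≥ 4 / char. `p`.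
* `resVertex_apply_eq_zero_of_untranslated` — on a constant-`(d, e_G = 2)` tail with chart letters in the
  untranslated pair `{a, a′}`, a letter `c̄ ∉ {a, a′}` that is never translated is orthogonal to the whole polar
  kernel: the kernel is spanned by the current direction and the persisting line `V ⊓ H_{j k}`, which at the next
  letter change (FT) IS the satellite direction, (SAT-PREDICTED) `…SatChain.chain_satellite_direction_eq_smul`.
* `no_tilt_at_letter_change_one` — `…CornerTransfer.no_tilt_at_letter_change` with tilts on ONE free letter.
* `no_binary_pair_tail_three` — THE CLASS THEOREM: no isolated above-floor witnessed `Step0 p` chain with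
  `x^{r₀} ∣ F₀` has, from some `k₀` on, constant natural shade `d < p`, `e_G ≡ 2`, chart letters in `{a, a′}`,
  `a, a′` permanent light boundary letters, a third letter never translated, and the fourth letter free.
[cite: CossartJannsenSaito2020, Thm. 3.10(4), Thm. 3.14, Lemma 13.2, Lemma 13.4, Thm. 13.7]
bears_on: LADDER-RESOLUTION:D157-DOOR2 (res-dim4-pi · K2(p) = `RidgeBudget.NoAboveFloorTrap p p` · slice C).
Supports stmt-ResolutionOfSingularities-16155 (helper).
-/

set_option linter.dupNamespace false -- mandated namespace of this single-conjunct summit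

noncomputable section

namespace Summit.ResolutionOfSingularities.ResolutionOfSingularities.Theorems.PIDim4

namespace ResCone

open MvPolynomial Finset
open Literature.AlgebraicGeometry.Resolution
open Literature.AlgebraicGeometry.Resolution.CentreBlowup
open Literature.AlgebraicGeometry.Resolution.Hauser2010
open Literature.AlgebraicGeometry.Resolution.HauserPerlega2019
open PointBlowup (polarMap additiveSubspace direction)
open FrameChange (tsch)

variable {K : Type} [Field K]

section Three

variable (p : ℕ) [Fact p.Prime] [CharP K p] [DecidableEq K]

/-- **AN UNTRANSLATED LETTER IS ORTHOGONAL TO THE KERNEL**: on a constant-`(d, e_G = 2)` tail with chart letters in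
`{a, a′}` and free translations w.r.t. the boundary, a letter `c̄ ∉ {a, a′}` with `b k c̄ = 0` for all `k ≥ k₀` has
`w c̄ = 0` for every kernel vector `w ∈ resVertex (c k)`, `k ≥ k₀`. [OURS]
[cite: CossartJannsenSaito2020, Thm. 3.10(4), Thm. 3.14] -/
theorem resVertex_apply_eq_zero_of_untranslated {c : ℕ → State K} {j : ℕ → Fin 4} {b : ℕ → Fin 4 → K}
    (hc : ∀ k, IsIsolated p (c k).F ∧ Step0 p (c k) (c (k + 1))) (hw : FreeTail.IsWitnessedChain p c j b)
    (hr0 : ∀ e ∈ (c 0).F.support, (c 0).r ≤ e) (hfloor : ∀ k, ordZero (c k).F ≠ p) {k₀ : ℕ} {d : ℕ∞}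
    (hshade : ∀ k, k₀ ≤ k → (c k).shade = d) (he : ∀ k, k₀ ≤ k → Module.finrank K (resVertex (c k)) = 2)
    {a a' : Fin 4} (hletters : ∀ k, k₀ ≤ k → (j k = a ∨ j k = a'))
    (hperm : ∀ k, k₀ ≤ k → b k a = 0 ∧ b k a' = 0) {cb : Fin 4} (hcba : cb ≠ a) (hcba' : cb ≠ a')
    (huntr : ∀ k, k₀ ≤ k → b k cb = 0) {k : ℕ} (hk : k₀ ≤ k) :
    ∀ w ∈ resVertex (c k), w cb = 0 := by
  -- the first letter change at or after `k` (FT)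
  have hex : ∃ n, k ≤ n ∧ j (n + 1) ≠ j n := by
    by_contra h; push Not at h
    obtain ⟨m, hm⟩ := FreeTailProof.noIsolatedFreeTailAt_self p K c j b k hw (fun n hn hsat => hsat.1 (h n hn))
    exact hm (hc m).1
  classical
  let n₁ := Nat.find hex
  have hn₁ : k ≤ n₁ ∧ j (n₁ + 1) ≠ j n₁ := Nat.find_spec hex
  have hrun : ∀ m, k ≤ m → m ≤ n₁ → j m = j k := by
    intro m hkm hmn
    induction m, hkm using Nat.le_induction with
    | base => rfl
    | succ m hkm ih =>
      have hlt : m < n₁ := by omega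
      have hmin := Nat.find_min hex hlt
      push Not at hmin
      rw [← ih (by omega), (hmin hkm)]
  -- notation: chart letter `x = j k`, the line `V_k ⊓ H_x` and a generator `π`
  obtain ⟨o, ho, hpo, ho2⟩ := chain_band p hc hfloor k
  have hrk := IsolatedBand.isolated_chain_forall_le hc hr0
  have hline : Module.finrank K ↥(resVertex (c k) ⊓ hyperplane (j k)) = 1 := by
    have h := finrank_resVertex_inf_hyperplane_add_one (j k) (hw k).2.1 ho (hrk k) hpo ho2
      (chain_shade_step p hw hshade hk)
    rw [he k hk] at h
    omega
  obtain ⟨π, hπ, hπ0⟩ : ∃ π ∈ resVertex (c k) ⊓ hyperplane (j k), π ≠ 0 := by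
    by_contra h
    push Not at h
    have hbot : resVertex (c k) ⊓ hyperplane (j k) = ⊥ := by rw [Submodule.eq_bot_iff]; exact h
    rw [hbot, finrank_bot] at hline
    exact zero_ne_one hline
  have hπx : π (j k) = 0 := mem_hyperplane.mp (Submodule.mem_inf.mp hπ).2
  -- `π` persists along the run up to `n₁`
  have hpers : ∀ m, k ≤ m → m ≤ n₁ → π ∈ resVertex (c m) := by
    intro m hkm hmn
    induction m, hkm using Nat.le_induction with
    | base => exact (Submodule.mem_inf.mp hπ).1
    | succ m hkm ih =>
      have hI2 := chain_resVertex_step_inf_hyperplane_eq p hc hw hr0 hfloor hshade he (k := m) (by omega)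
      have hjm : j m = j k := hrun m hkm (by omega)
      have hmem : π ∈ resVertex (c m) ⊓ hyperplane (j m) :=
        Submodule.mem_inf.mpr ⟨ih (by omega), mem_hyperplane.mpr (by rw [hjm]; exact hπx)⟩
      rw [← hI2] at hmem
      exact (Submodule.mem_inf.mp hmem).1
  -- the change at `n₁` is a satellite (the pair is never translated), so `π` is its direction up to scale
  have hsat : FreeTail.IsSatellite j b n₁ := by
    refine ⟨hn₁.2, ?_⟩
    rcases hletters n₁ (by omega) with h | h <;> rw [h]
    exacts [(hperm (n₁ + 1) (by omega)).1, (hperm (n₁ + 1) (by omega)).2]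
  have hπn : π (j n₁) = 0 := by rw [hrun n₁ hn₁.1 le_rfl]; exact hπx
  obtain ⟨hπy, hdir⟩ := chain_satellite_direction_eq_smul p hc hw hr0 hfloor hshade (k := n₁) (by omega) hsat
    (by rw [he n₁ (by omega)]) (hpers n₁ hn₁.1 le_rfl) hπn hπ0
  have hπcb : π cb = 0 := by
    have h := congrFun hdir cb
    have hjcb : cb ≠ j (n₁ + 1) := by
      rcases hletters (n₁ + 1) (by omega) with h' | h' <;> rw [h']; exacts [hcba, hcba']
    rw [direction_apply_of_ne hjcb, huntr (n₁ + 1) (by omega), Pi.smul_apply, smul_eq_mul] at h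
    rcases mul_eq_zero.mp h.symm with h1 | h1; exacts [absurd h1 (inv_ne_zero hπy), h1]
  -- every kernel vector is `(w x)·v_k + t·π`
  intro w hwV
  have hv := chain_direction_mem_resVertex p hc hw hr0 hfloor hshade hk
  set w' := w - w (j k) • direction (j k) (b k) with hw'
  have hw'V : w' ∈ resVertex (c k) ⊓ hyperplane (j k) :=
    Submodule.mem_inf.mpr ⟨Submodule.sub_mem _ hwV (Submodule.smul_mem _ _ hv), mem_hyperplane.mpr (by
      rw [hw', Pi.sub_apply, Pi.smul_apply, direction_apply_self, smul_eq_mul, mul_one, sub_self])⟩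
  obtain ⟨t, ht⟩ := (finrank_eq_one_iff_of_nonzero' (⟨π, hπ⟩ : ↥(resVertex (c k) ⊓ hyperplane (j k)))
    (by rw [Ne, Submodule.mk_eq_zero]; exact hπ0)).mp hline ⟨w', hw'V⟩
  have ht' : t • π = w' := by
    have := congrArg Subtype.val ht
    simpa using this
  have hjcb : cb ≠ j k := by
    rcases hletters k hk with h' | h' <;> rw [h']
    · exact hcba
    · exact hcba'
  have h1 : w cb = w' cb + w (j k) * direction (j k) (b k) cb := by
    rw [hw', Pi.sub_apply, Pi.smul_apply, smul_eq_mul]; ring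
  rw [h1, ← ht', Pi.smul_apply, smul_eq_mul, hπcb, mul_zero, zero_add, direction_apply_of_ne hjcb,
    huntr k hk, mul_zero]

/-- **NO TILT AT A LETTER CHANGE, one free letter**: as `…CornerTransfer.no_tilt_at_letter_change` with the tilts
`α, γ` supported on ONE free letter `f` — one re-framing along `f`. [OURS]
[cite: CossartJannsenSaito2020, Thm. 3.10(4), Thm. 3.14, Lemma 13.2, Thm. 13.7] -/
theorem no_tilt_at_letter_change_one {c : ℕ → State K} {j : ℕ → Fin 4} {β : ℕ → Fin 4 → K}
    (hc : ∀ k, IsIsolated p (c k).F ∧ Step0 p (c k) (c (k + 1))) (hw : FreeTail.IsWitnessedChain p c j β)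
    (hr0 : ∀ e ∈ (c 0).F.support, (c 0).r ≤ e) (hfloor : ∀ k, ordZero (c k).F ≠ p) {k₀ d : ℕ} (hdp : d < p)
    (hshade : ∀ k, k₀ ≤ k → (c k).shade = (d : ℕ∞)) {a a' : Fin 4} (haa : a ≠ a')
    (hletters : ∀ k, k₀ ≤ k → (j k = a ∨ j k = a'))
    (he : ∀ k, k₀ ≤ k → Module.finrank K (resVertex (c k)) = 2)
    (hbdry : ∀ k, k₀ ≤ k → 1 ≤ (c k).r a ∧ 1 ≤ (c k).r a')
    (hlight : ∀ k, k₀ ≤ k → (c k).r a + (c k).r a' ≤ 2 * (c (k + 1)).r (j k))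
    (hfreeT : ∀ k, k₀ ≤ k → ∀ i, β k i ≠ 0 → (c k).r i = 0)
    {k₁ : ℕ} (hk₁ : k₀ ≤ k₁) (hj₁ : j k₁ = a') (hj₂ : j (k₁ + 1) = a)
    {f : Fin 4} (hfa : f ≠ a) (hfa' : f ≠ a') (hfree : (c (k₁ + 1)).r f = 0 ∧ f ∉ (c (k₁ + 1)).exc)
    {α γ : Fin 4 → K} (hαs : ∀ i, i ≠ f → α i = 0) (hγs : ∀ i, i ≠ f → γ i = 0)
    (htilt : Pi.single a 1 + α ∈ resVertex (c (k₁ + 1)) ∧ Pi.single a' 1 + γ ∈ resVertex (c (k₁ + 1))) :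
    False := by
  -- the initial-degree law for `a′` at the child of the `a′`-step `k₁`
  obtain ⟨o, ho, hpo, ho2⟩ := chain_band p hc hfloor k₁
  have hrk := IsolatedBand.isolated_chain_forall_le hc hr0
  have hstep := (hw k₁).2.2.2.2
  have hbj : β k₁ (j k₁) = 0 := (hw k₁).2.1
  have heqsh : (CentreBlowup.step p Finset.univ (j k₁) (β k₁) (c k₁)).shade = (c k₁).shade :=
    chain_shade_step p hw hshade hk₁
  have hd : o - (c k₁).r.degree = d := ordZero_sub_degree_eq_of_shade ho (hshade k₁ hk₁)
  have hP : ∀ E ∈ (c (k₁ + 1)).F.support, E a' = (c (k₁ + 1)).r a' →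
      E.degree = (c (k₁ + 1)).r.degree + d := by
    intro E hE hEa
    rw [hstep] at hE hEa ⊢
    rw [hj₁] at hE hEa hbj heqsh ⊢
    have h := degree_eq_of_mem_support_step_of_apply_eq a' hbj ho (hrk k₁) hpo ho2 heqsh (hfreeT k₁ hk₁) hE hEa
    rw [hd] at h
    exact h
  -- the shifted tail from `m = k₁ + 1`
  set m := k₁ + 1 with hm
  have hwT : FreeTail.IsWitnessedChain p (fun k => c (m + k)) (fun k => j (m + k)) (fun k => β (m + k)) := by
    intro k
    have h := hw (m + k)
    rwa [show m + k + 1 = m + (k + 1) by ring] at h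
  have hcT : ∀ k, IsIsolated p ((fun k => c (m + k)) k).F ∧
      Step0 p ((fun k => c (m + k)) k) ((fun k => c (m + k)) (k + 1)) := fun k => by
    have h := hc (m + k)
    rwa [show m + k + 1 = m + (k + 1) by ring] at h
  have hcleanT : deletePthPowers p (c (m + 0)).F = (c (m + 0)).F := by
    rw [Nat.add_zero, hm, hstep]
    exact FrameChange.deletePthPowers_step_F p _ _ _ _
  have hjf : ∀ k, j (m + k) ≠ f := fun k => by
    rcases hletters (m + k) (by omega) with h | h <;> rw [h]
    · exact hfa.symm
    · exact hfa'.symm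
  have hm0 : c (m + 0) = c (k₁ + 1) := by rw [Nat.add_zero]
  set lam : Fin 4 → K := fun i => if i = a then α f else if i = a' then γ f else 0 with hlam
  have hlamf : lam f = 0 := by simp only [hlam, if_neg hfa, if_neg hfa']
  obtain ⟨c₁, b₁, hc₁, hw₁, hr0₁, hfloor₁, -, hshade₁, he₁, hfreeT₁, hreq₁, hV₁, hP₁⟩ :=
    exists_reframed_tail p hcT hwT (by rw [hm0]; exact hrk (k₁ + 1)) (fun k => hfloor (m + k)) hcleanT
      (fun k => hshade (m + k) (by omega)) (fun k => he (m + k) (by omega))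
      (fun k i hbi => hfreeT (m + k) (by omega) i hbi) hjf (by rw [hm0]; exact hfree.1)
      (by rw [hm0]; exact hfree.2) lam hlamf hfa'.symm (N := (c (k₁ + 1)).r.degree + d) (by rw [hm0]; exact hP)
  have hαa : α a = 0 := hαs a hfa.symm; have hαa' : α a' = 0 := hαs a' hfa'.symm
  have hγa : γ a = 0 := hγs a hfa.symm; have hγa' : γ a' = 0 := hγs a' hfa'.symm
  have hsum : ∀ w : Fin 4 → K, w a' = 0 → ∑ i, lam i * w i = α f * w a := by
    intro w hwa'
    rw [Finset.sum_eq_single a]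
    · simp only [hlam, if_true]
    · intro i _ hia
      simp only [hlam, if_neg hia]
      split_ifs with hia'; exacts [by rw [hia', hwa', mul_zero], by rw [zero_mul]]
    · intro h; exact absurd (Finset.mem_univ a) h
  have hsum' : ∀ w : Fin 4 → K, w a = 0 → ∑ i, lam i * w i = γ f * w a' := by
    intro w hwa
    rw [Finset.sum_eq_single a']
    · simp only [hlam, if_neg haa.symm, if_true]
    · intro i _ hia'
      simp only [hlam, if_neg hia']
      split_ifs with hia; exacts [by rw [hia, hwa, mul_zero], by rw [zero_mul]]
    · intro h; exact absurd (Finset.mem_univ a') h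
  have hva : (Pi.single a 1 + α : Fin 4 → K) a = 1 := by rw [Pi.add_apply, Pi.single_eq_same, hαa, add_zero]
  have hva' : (Pi.single a 1 + α : Fin 4 → K) a' = 0 := by
    rw [Pi.add_apply, Pi.single_eq_of_ne haa.symm, hαa', add_zero]
  have hua : (Pi.single a' 1 + γ : Fin 4 → K) a = 0 := by rw [Pi.add_apply, Pi.single_eq_of_ne haa, hγa, add_zero]
  have hua' : (Pi.single a' 1 + γ : Fin 4 → K) a' = 1 := by rw [Pi.add_apply, Pi.single_eq_same, hγa', add_zero]
  have hvf : (Pi.single a 1 + α : Fin 4 → K) f = α f := by rw [Pi.add_apply, Pi.single_eq_of_ne hfa, zero_add]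
  have huf : (Pi.single a' 1 + γ : Fin 4 → K) f = γ f := by rw [Pi.add_apply, Pi.single_eq_of_ne hfa', zero_add]
  have hvalv : (Pi.single a 1 + α : Fin 4 → K) f - ∑ i, lam i * (Pi.single a 1 + α : Fin 4 → K) i = 0 := by
    rw [hsum _ hva', hva, mul_one, hvf, sub_self]
  have hvalu : (Pi.single a' 1 + γ : Fin 4 → K) f - ∑ i, lam i * (Pi.single a' 1 + γ : Fin 4 → K) i = 0 := by
    rw [hsum' _ hua, hua', mul_one, huf, sub_self]
  -- the frame at `c₁ 0`
  have hframe : (Pi.single a 1 : Fin 4 → K) ∈ resVertex (c₁ 0) ∧ (Pi.single a' 1 : Fin 4 → K) ∈ resVertex (c₁ 0) := by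
    constructor
    · have h := update_mem_of_transport hlamf hV₁ (v := Pi.single a 1 + α) (by rw [hm0]; exact htilt.1)
      rw [hvalv] at h
      convert h using 1
      funext i
      by_cases hi : i = f
      · subst hi
        rw [Function.update_self, Pi.single_eq_of_ne hfa]
      · rw [Function.update_of_ne hi, Pi.add_apply, hαs i hi, add_zero]
    · have h := update_mem_of_transport hlamf hV₁ (v := Pi.single a' 1 + γ) (by rw [hm0]; exact htilt.2)
      rw [hvalu] at h
      convert h using 1
      funext i
      by_cases hi : i = f
      · subst hi
        rw [Function.update_self, Pi.single_eq_of_ne hfa']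
      · rw [Function.update_of_ne hi, Pi.add_apply, hγs i hi, add_zero]
  have hr₁ : ∀ k, (c₁ k).r = (c (m + k)).r := fun k => (hreq₁ k).1
  refine no_frame_of_initialDegree p hc₁ hw₁ hr0₁ hfloor₁ hdp (k₀ := 0) (fun k _ => hshade₁ k) haa
    (fun k _ => hletters (m + k) (by omega)) (fun k _ => he₁ k) (fun k _ => ?_) (fun k _ => ?_) (k₁ := 0)
    le_rfl (by show j (m + 0) = a; rw [Nat.add_zero]; exact hj₂) hframe (fun E hE hEa => ?_)
  · rw [hr₁ k]; exact hbdry (m + k) (by omega)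
  · rw [hr₁ k, hr₁ (k + 1), show m + (k + 1) = m + k + 1 by ring]
    exact hlight (m + k) (by omega)
  · rw [hr₁ 0, Nat.add_zero]
    exact hP₁ E hE hEa

/-- Four pairwise distinct letters exhaust `Fin 4`. [folklore] -/
theorem eq_or_eq_or_eq_or_eq {a a' cb f : Fin 4} (haa : a ≠ a') (hcba : cb ≠ a) (hcba' : cb ≠ a') (hfa : f ≠ a)
    (hfa' : f ≠ a') (hfcb : f ≠ cb) (i : Fin 4) : i = a ∨ i = a' ∨ i = cb ∨ i = f := by
  have hcard : ({a, a', cb, f} : Finset (Fin 4)).card = Fintype.card (Fin 4) := by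
    rw [Finset.card_insert_of_notMem (by simp [haa, hcba.symm, hfa.symm]),
      Finset.card_insert_of_notMem (by simp [hcba'.symm, hfa'.symm]),
      Finset.card_insert_of_notMem (by simp [hfcb.symm]), Finset.card_singleton, Fintype.card_fin]
  have huniv := Finset.eq_univ_of_card _ hcard
  have hi : i ∈ ({a, a', cb, f} : Finset (Fin 4)) := by rw [huniv]; exact Finset.mem_univ i
  simpa [Finset.mem_insert, Finset.mem_singleton] using hi

/-- The class theorem at a given letter change `a′ → a` (third letter `c̄` never translated, free letter `f`). [OURS]
[cite: CossartJannsenSaito2020, Thm. 3.10(4), Thm. 3.14, Lemma 13.2, Lemma 13.4, Thm. 13.7] -/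
theorem no_binary_pair_tail_three_at {c : ℕ → State K} {j : ℕ → Fin 4} {b : ℕ → Fin 4 → K}
    (hc : ∀ k, IsIsolated p (c k).F ∧ Step0 p (c k) (c (k + 1))) (hw : FreeTail.IsWitnessedChain p c j b)
    (hr0 : ∀ e ∈ (c 0).F.support, (c 0).r ≤ e) (hfloor : ∀ k, ordZero (c k).F ≠ p) {k₀ d : ℕ} (hdp : d < p)
    (hshade : ∀ k, k₀ ≤ k → (c k).shade = (d : ℕ∞)) {a a' cb f : Fin 4} (haa : a ≠ a') (hcba : cb ≠ a)
    (hcba' : cb ≠ a') (hfa : f ≠ a) (hfa' : f ≠ a') (hfcb : f ≠ cb)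
    (hletters : ∀ k, k₀ ≤ k → (j k = a ∨ j k = a'))
    (he : ∀ k, k₀ ≤ k → Module.finrank K (resVertex (c k)) = 2)
    (hbdry : ∀ k, k₀ ≤ k → 1 ≤ (c k).r a ∧ 1 ≤ (c k).r a')
    (huntr : ∀ k, k₀ ≤ k → b k cb = 0)
    (hfree : ∀ k, k₀ ≤ k → (c k).r f = 0 ∧ f ∉ (c k).exc)
    (hlight : ∀ k, k₀ ≤ k → (c k).r a + (c k).r a' ≤ 2 * (c (k + 1)).r (j k))
    {k₁ : ℕ} (hk₁ : k₀ ≤ k₁) (hj₁ : j k₁ = a') (hj₂ : j (k₁ + 1) = a) : False := by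
  have hrk := IsolatedBand.isolated_chain_forall_le hc hr0
  have hfour := eq_or_eq_or_eq_or_eq haa hcba hcba' hfa hfa' hfcb
  -- nothing but `f` is ever translated
  have hzero : ∀ k, k₀ ≤ k → ∀ i, i ≠ f → b k i = 0 := by
    intro k hk i hif
    by_cases hij : i = j k
    · rw [hij]; exact (hw k).2.1
    by_contra hbi
    obtain ⟨o, ho, -, -⟩ := chain_band p hc hfloor k
    have h0 := step_r_apply_eq_zero_of_ne p (j k) (hw k).2.1 (c k) ho (hrk k) hij hbi
    rw [← (hw k).2.2.2.2] at h0
    rcases hfour i with hi | hi | hi | hi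
    · have := (hbdry (k + 1) (by omega)).1; rw [← hi] at this; omega
    · have := (hbdry (k + 1) (by omega)).2; rw [← hi] at this; omega
    · exact hbi (by rw [hi]; exact huntr k hk)
    · exact hif hi
  have hfreeT : ∀ k, k₀ ≤ k → ∀ i, b k i ≠ 0 → (c k).r i = 0 := by
    intro k hk i hbi
    by_cases hif : i = f
    · rw [hif]; exact (hfree k hk).1
    · exact absurd (hzero k hk i hif) hbi
  have hperm : ∀ k, k₀ ≤ k → b k a = 0 ∧ b k a' = 0 := fun k hk =>
    ⟨hzero k hk a hfa.symm, hzero k hk a' hfa'.symm⟩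
  set m := k₁ + 1 with hm
  -- `α = b m`, supported on `{f}`
  have hv : direction (j m) (b m) ∈ resVertex (c m) :=
    chain_direction_mem_resVertex p hc hw hr0 hfloor hshade (by omega)
  have hdir : direction (j m) (b m) = Pi.single a 1 + b m := by
    funext i
    rw [hj₂]
    by_cases hia : i = a
    · rw [hia, direction_apply_self, Pi.add_apply, Pi.single_eq_same, (hperm m (by omega)).1, add_zero]
    · rw [direction_apply_of_ne hia, Pi.add_apply, Pi.single_eq_of_ne hia, zero_add]
  -- `γ` from the line `resVertex (c m) ⊓ H_a`
  obtain ⟨o, ho, hpo, ho2⟩ := chain_band p hc hfloor m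
  have heqsh : (CentreBlowup.step p Finset.univ (j m) (b m) (c m)).shade = (c m).shade :=
    chain_shade_step p hw hshade (k := m) (by omega)
  have hline : Module.finrank K ↥(resVertex (c m) ⊓ hyperplane a) = 1 := by
    have h := finrank_resVertex_inf_hyperplane_add_one (j m) (hw m).2.1 ho (hrk m) hpo ho2 heqsh
    rw [hj₂, he m (by omega)] at h
    omega
  obtain ⟨π, hπ, hπ0⟩ : ∃ π ∈ resVertex (c m) ⊓ hyperplane a, π ≠ 0 := by
    by_contra h
    push Not at h
    have hbot : resVertex (c m) ⊓ hyperplane a = ⊥ := by rw [Submodule.eq_bot_iff]; exact h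
    rw [hbot, finrank_bot] at hline
    exact zero_ne_one hline
  have hπV : π ∈ resVertex (c m) := (Submodule.mem_inf.mp hπ).1
  have hπa : π a = 0 := mem_hyperplane.mp (Submodule.mem_inf.mp hπ).2
  have hπa' : π a' ≠ 0 := fun h0 =>
    hπ0 (no_passive_kernel_vector p hc hw hr0 hfloor hshade he hletters (k := m) (by omega) hπV hπa h0)
  have hπcb : π cb = 0 :=
    resVertex_apply_eq_zero_of_untranslated p hc hw hr0 hfloor hshade he hletters hperm hcba hcba'
      (fun k hk => hzero k hk cb hfcb.symm) (k := m) (by omega) π hπV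
  set γ : Fin 4 → K := (π a')⁻¹ • π - Pi.single a' 1 with hγ
  have hγV : Pi.single a' 1 + γ ∈ resVertex (c m) := by
    have : Pi.single a' 1 + γ = (π a')⁻¹ • π := by rw [hγ]; abel
    rw [this]
    exact Submodule.smul_mem _ _ hπV
  have hγs : ∀ i, i ≠ f → γ i = 0 := by
    intro i hif
    rcases hfour i with hi | hi | hi | hi
    · rw [hi]; simp only [hγ, Pi.sub_apply, Pi.smul_apply, smul_eq_mul, hπa, mul_zero, Pi.single_eq_of_ne haa,
        sub_zero]
    · rw [hi]; simp only [hγ, Pi.sub_apply, Pi.smul_apply, smul_eq_mul, inv_mul_cancel₀ hπa', Pi.single_eq_same,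
        sub_self]
    · rw [hi]; simp only [hγ, Pi.sub_apply, Pi.smul_apply, smul_eq_mul, hπcb, mul_zero,
        Pi.single_eq_of_ne hcba', sub_zero]
    · exact absurd hi hif
  exact no_tilt_at_letter_change_one p hc hw hr0 hfloor hdp hshade haa hletters he hbdry hlight hfreeT hk₁ hj₁ hj₂
    hfa hfa' (hfree m (by omega)) (fun i hi => hzero m (by omega) i hi) hγs ⟨by rw [← hdir]; exact hv, hγV⟩

/-- **NO BINARY-CONE TAIL ON A LIGHT PAIR WITH A THIRD, IDLE LETTER** (idea-4's class A∞ made `p`-, `d`-free):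
no isolated above-floor witnessed `Step0 p` chain with `x^{r₀} ∣ F₀` has, from some `k₀` on, constant natural shade
`d < p`, `e_G ≡ 2`, chart letters in `{a, a′}`, `a, a′` permanent light boundary letters, a third letter `c̄` NEVER
TRANSLATED (e.g. a permanent boundary letter), and the fourth letter `f` free. [OURS]
[cite: CossartJannsenSaito2020, Thm. 3.10(4), Thm. 3.14, Lemma 13.2, Lemma 13.4, Thm. 13.7] -/
theorem no_binary_pair_tail_three {c : ℕ → State K} {j : ℕ → Fin 4} {b : ℕ → Fin 4 → K}
    (hc : ∀ k, IsIsolated p (c k).F ∧ Step0 p (c k) (c (k + 1))) (hw : FreeTail.IsWitnessedChain p c j b)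
    (hr0 : ∀ e ∈ (c 0).F.support, (c 0).r ≤ e) (hfloor : ∀ k, ordZero (c k).F ≠ p) {k₀ d : ℕ} (hdp : d < p)
    (hshade : ∀ k, k₀ ≤ k → (c k).shade = (d : ℕ∞)) {a a' cb f : Fin 4} (haa : a ≠ a') (hcba : cb ≠ a)
    (hcba' : cb ≠ a') (hfa : f ≠ a) (hfa' : f ≠ a') (hfcb : f ≠ cb)
    (hletters : ∀ k, k₀ ≤ k → (j k = a ∨ j k = a'))
    (he : ∀ k, k₀ ≤ k → Module.finrank K (resVertex (c k)) = 2)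
    (hbdry : ∀ k, k₀ ≤ k → 1 ≤ (c k).r a ∧ 1 ≤ (c k).r a')
    (huntr : ∀ k, k₀ ≤ k → b k cb = 0)
    (hfree : ∀ k, k₀ ≤ k → (c k).r f = 0 ∧ f ∉ (c k).exc)
    (hlight : ∀ k, k₀ ≤ k → (c k).r a + (c k).r a' ≤ 2 * (c (k + 1)).r (j k)) : False := by
  have hsat : ∃ n, k₀ ≤ n ∧ FreeTail.IsSatellite j b n := by
    by_contra h
    push Not at h
    obtain ⟨m, hm⟩ := FreeTailProof.noIsolatedFreeTailAt_self p K c j b k₀ hw h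
    exact hm (hc m).1
  obtain ⟨n, hn, hsatn⟩ := hsat
  have hchg : j (n + 1) ≠ j n := hsatn.1
  rcases hletters n hn with hja | hja'
  · have hja'2 : j (n + 1) = a' := by
      rcases hletters (n + 1) (by omega) with h | h
      · exact absurd (h.trans hja.symm) hchg
      · exact h
    exact no_binary_pair_tail_three_at p hc hw hr0 hfloor hdp hshade haa.symm hcba' hcba hfa' hfa hfcb
      (fun k hk => (hletters k hk).symm) he (fun k hk => (hbdry k hk).symm) huntr hfree
      (fun k hk => by rw [add_comm]; exact hlight k hk) hn hja hja'2
  · have hja2 : j (n + 1) = a := by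
      rcases hletters (n + 1) (by omega) with h | h
      · exact h
      · exact absurd (h.trans hja'.symm) hchg
    exact no_binary_pair_tail_three_at p hc hw hr0 hfloor hdp hshade haa hcba hcba' hfa hfa' hfcb hletters he hbdry
      huntr hfree hlight hn hja' hja2

end Three

end ResCone

end Summit.ResolutionOfSingularities.ResolutionOfSingularities.Theorems.PIDim4

end
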